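import Literature.NumberTheory.EllipticCurves.Aoki1999.CongruentTwoSelmerClosedFormula
import Literature.NumberTheory.EllipticCurves.HeathBrown1994.CongruentTwoSelmerMonskyFamilies
import Literature.NumberTheory.EllipticCurves.QuadraticTwistTwoLFunctionProofs
import Mathlib.NumberTheory.LegendreSymbol.JacobiSymbol
import HarnessLib

/-!
# Cell `bsd-monsky`: Aoki's data on the even-five two-prime family `n = 2pq` — the sets `S, T, S₁, S₂`
# and the Hilbert symbols `λ_ℓ(x)`, `ℓ, x ∈ {2, p, q}`, evaluated (nothing asserted)

HONEST FRAMING (cell `bsd-monsky`, run/shared/lean/pub/bsd-monsky/, README §1: ONE theorem on ONE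
explicit infinite family of quadratic twists of the congruent number curve at the prime `2`; not
"BSD for rank ≤ 1", nothing at odd primes, nothing booked until the cross-family referee passes the
written proof). This file asserts NO arithmetic fact and carries NO named-fact binder: it is the
bookkeeping needed to EVALUATE Aoki's Theorem 2.2 (the named fact
`Literature.NumberTheory.EllipticCurves.Aoki1999.thm22_card_selmerGroup_two`, refereed and fully proved
in print — the first such source in the tree for the family's `2`-Selmer input) on
`n = 2pq`, `p ≡ 5 (mod 8)`, `q ≡ 3 (mod 4)` primes (BOTH Legendre halves `(p/q) = ±1`):

* §1 the finite sets of Aoki p. 80–81 on the family: `S = {2, p, q}`, `T₁ = T = {p}` (`2pq ≡ 6 (mod 8)`),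
  `S₁ = {p, q}`, `S₂ = {q}` (`Finset` identities from `Nat.primeFactors`);
* §2 the Hilbert symbols `(−2pq, x)_ℓ` for `ℓ ∈ {p, q}`, `x ∈ {2, p, q}`, and `(2, x)_2`, computed
  from Serre's explicit formula (the tree's `localSign`, = the genuine symbol of `ℚ_ℓ` by
  `hilbertSymbol_padic_intCast`) through the Jacobi-symbol supplements and quadratic reciprocity:
  `(−2pq, 2)_p = (2/p) = −1`, `(−2pq, p)_p = −(q/p)`, `(−2pq, q)_p = (q/p)`, `(−2pq, p)_q = (p/q)`,
  `(−2pq, q)_q = (2/q)(p/q)`, `(2, p)_2 = χ₈(p) = −1`, `(2, q)_2 = (2/q)`;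
* §3 the same as elements of `ℤ/2ℤ` (Aoki's `λ`): `λ_p(2) = 1`, `λ₂(p) = 1`, `λ_p(p) = 0 ↔ (q/p) = −1`,
  `λ_p(q) = 0 ↔ (q/p) = 1`, `λ_q(p) = 0 ↔ (p/q) = 1`, `λ_q(q) = λ₂(q)` when `(p/q) = 1`;
* §4 two rank lemmas (a non-zero entry forces rank `≥ 1`; one column forces rank `≤ 1`).

The divisibility helper `¬ ℓ ∣ 2` for an odd prime `ℓ` is the tree's `WeierstrassCurve.not_dvd_two_of_prime_ne_two`
(`QuadraticTwistTwoLFunctionProofs.lean`), reused, not re-declared.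

The evaluation itself (`|S| = 3`, `|T| = 1`, `rank Λ_{S,T} = 1`, the Gram matrix on `v_{S₁}(Sel₀)` is
zero, hence `dim Sel^(2)(E_{2pq}/ℚ) = 3`, `#Sel₂ = 8`) and the enclosure corners of C-P2-1 with Aoki's
fact live in the sequel `P2/CongruentNumberSilentEvenFiveSelmerEightAoki.lean`.

References: [Aoki1999] §2 pp. 79–81, §4 pp. 86–87; [Serre1973] Ch. III §1.2 Thm. 1 (the tree's
`localSign` lemmas); [IrelandRosen1990] Ch. 5 §2 (Jacobi-symbol supplements and reciprocity, the tree's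
`HeathBrown1994.Families` lemmas).
-/

noncomputable section

open scoped Classical

open WeierstrassCurve Literature.NumberTheory.EllipticCurves
  Literature.NumberTheory.EllipticCurves.Aoki1999
  Literature.NumberTheory.EllipticCurves.HeathBrown1994.Families
  Literature.NumberTheory.QuadraticForms

set_option autoImplicit false

namespace Summit.BirchSwinnertonDyer.Rank1Residual.P2

section Family

variable {p q : ℕ}

/-! ## §1 The sets `S, T₁, T, S₁, S₂` of Aoki p. 80–81 on `n = 2pq` -/

/-- `2pq ≡ 6 (mod 8)` for `p ≡ 5 (mod 8)`, `q ≡ 3 (mod 4)`. [folklore] -/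
theorem two_mul_five_mul_mod_eight (hp8 : p % 8 = 5) (hq4 : q % 4 = 3) :
    (2 * (p * q)) % 8 = 6 := by
  have hq8 : q % 8 = 3 ∨ q % 8 = 7 := by omega
  rw [Nat.mul_mod, Nat.mul_mod p q, hp8]
  rcases hq8 with h | h <;> rw [h]

/-- `S = {2, p, q}` for `n = 2pq`. [cite: Aoki1999, §2 p. 80] -/
theorem sSet_two_mul_five_mul (hp : p.Prime) (hq : q.Prime) : sSet (2 * (p * q)) = {2, p, q} := by
  unfold sSet
  rw [Nat.primeFactors_mul two_ne_zero (mul_ne_zero hp.ne_zero hq.ne_zero),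
    Nat.primeFactors_mul hp.ne_zero hq.ne_zero, Nat.prime_two.primeFactors, hp.primeFactors,
    hq.primeFactors]
  ext x
  simp only [Finset.mem_union, Finset.mem_singleton, Finset.mem_insert]

/-- `T₁ = {p}` for `n = 2pq`, `p ≡ 5 (mod 8)`, `q ≡ 3 (mod 4)`. [cite: Aoki1999, §2 p. 80] -/
theorem tOneSet_two_mul_five_mul (hp : p.Prime) (hq : q.Prime) (hp8 : p % 8 = 5) (hq4 : q % 4 = 3) :
    tOneSet (2 * (p * q)) = {p} := by
  unfold tOneSet
  rw [sSet_two_mul_five_mul hp hq]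
  ext x
  simp only [Finset.mem_filter, Finset.mem_insert, Finset.mem_singleton]
  constructor
  · rintro ⟨rfl | rfl | rfl, h⟩ <;> omega
  · rintro rfl
    exact ⟨Or.inr (Or.inl rfl), by omega⟩

/-- `T = T₁ = {p}` for `n = 2pq ≡ 6 (mod 8)`. [cite: Aoki1999, §2 p. 80] -/
theorem tSet_two_mul_five_mul (hp : p.Prime) (hq : q.Prime) (hp8 : p % 8 = 5) (hq4 : q % 4 = 3) :
    tSet (2 * (p * q)) = {p} := by
  unfold tSet
  rw [if_neg (by rw [two_mul_five_mul_mod_eight hp8 hq4]; omega),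
    tOneSet_two_mul_five_mul hp hq hp8 hq4]

/-- `S₁ = {p, q}` for `n = 2pq`. [cite: Aoki1999, §2 p. 80] -/
theorem sOneSet_two_mul_five_mul (hp : p.Prime) (hq : q.Prime) (hp8 : p % 8 = 5) (hq4 : q % 4 = 3) :
    sOneSet (2 * (p * q)) = {p, q} := by
  unfold sOneSet
  rw [sSet_two_mul_five_mul hp hq]
  ext x
  simp only [Finset.mem_filter, Finset.mem_insert, Finset.mem_singleton]
  constructor
  · rintro ⟨rfl | rfl | rfl, h⟩
    · exact absurd rfl h
    · exact Or.inl rfl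
    · exact Or.inr rfl
  · rintro (rfl | rfl)
    · exact ⟨Or.inr (Or.inl rfl), by omega⟩
    · exact ⟨Or.inr (Or.inr rfl), by omega⟩

/-- `S₂ = S₁ ∖ T = {q}` for `n = 2pq`. [cite: Aoki1999, Thm. 2.2 p. 81] -/
theorem sTwoSet_two_mul_five_mul (hp : p.Prime) (hq : q.Prime) (hp8 : p % 8 = 5) (hq4 : q % 4 = 3) :
    sTwoSet (2 * (p * q)) = {q} := by
  unfold sTwoSet
  rw [sOneSet_two_mul_five_mul hp hq hp8 hq4, tSet_two_mul_five_mul hp hq hp8 hq4]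
  ext x
  simp only [Finset.mem_sdiff, Finset.mem_insert, Finset.mem_singleton]
  constructor
  · rintro ⟨rfl | rfl, h⟩
    · exact absurd rfl h
    · rfl
  · rintro rfl
    exact ⟨Or.inr rfl, by omega⟩

/-! ## §2 The Hilbert symbols `(−2pq, x)_ℓ`, `(2, x)_2` on the family, `ℓ, x ∈ {2, p, q}` (integer signs) -/

/-- A prime does not divide a different prime (in `ℤ`). [folklore] -/
theorem not_dvd_of_ne {ℓ m : ℕ} (hℓ : ℓ.Prime) (hm : m.Prime) (h : ℓ ≠ m) : ¬ (ℓ : ℤ) ∣ (m : ℤ) :=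
  fun hd => h ((Nat.prime_dvd_prime_iff_eq hℓ hm).mp (by exact_mod_cast hd))

/-- An odd prime `ℓ ≠ m` does not divide `−2m` (in `ℤ`). [folklore] -/
theorem not_dvd_neg_two_mul {ℓ m : ℕ} (hℓ : ℓ.Prime) (hm : m.Prime) (h2 : ℓ ≠ 2) (h : ℓ ≠ m) :
    ¬ (ℓ : ℤ) ∣ -(2 * (m : ℤ)) := fun hd => by
  rw [dvd_neg] at hd
  rcases (Nat.prime_iff_prime_int.mp hℓ).dvd_mul.mp hd with hd | hd
  · exact not_dvd_two_of_prime_ne_two hℓ h2 hd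
  · exact not_dvd_of_ne hℓ hm h hd

/-- The integer `−n = −2pq` factored through an odd prime divisor `ℓ` of `n`: `−n = ℓ · m` with
`ℓ ∤ m`. [folklore] -/
theorem neg_two_mul_five_mul_eq (p q : ℕ) :
    -((2 * (p * q) : ℕ) : ℤ) = (p : ℤ) * (-(2 * (q : ℤ))) ∧
      -((2 * (p * q) : ℕ) : ℤ) = (q : ℤ) * (-(2 * (p : ℤ))) := by
  constructor <;> push_cast <;> ring

/-- `−2pq ≠ 0` (in `ℤ`). [folklore] -/
theorem neg_two_mul_five_mul_ne_zero (hp : p.Prime) (hq : q.Prime) :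
    -((2 * (p * q) : ℕ) : ℤ) ≠ 0 :=
  neg_ne_zero.mpr (by exact_mod_cast mul_ne_zero two_ne_zero (mul_ne_zero hp.ne_zero hq.ne_zero))

/-- `(−2pq, 2)_p = (2/p)`: `(p·(−2q), 2)_p = (p, 2)_p (−2q, 2)_p = (2/p)`. [cite: Serre1973, Ch. III §1.2 Thm. 1] -/
theorem localSign_prime_neg_n_two (hp : p.Prime) (hq : q.Prime) (hp8 : p % 8 = 5) (hq4 : q % 4 = 3) :
    localSign p (-((2 * (p * q) : ℕ) : ℤ)) 2 = jacobiSym 2 p := by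
  haveI : Fact p.Prime := ⟨hp⟩
  have h2 : p ≠ 2 := by omega
  have hne : p ≠ q := fun h => by omega
  have e1 : localSign p p 2 = legendreSym p 2 := by
    rw [localSign_comm]
    exact localSign_odd_unit_prime h2 (not_dvd_two_of_prime_ne_two hp h2)
  have e2 : localSign p (-(2 * (q : ℤ))) 2 = 1 :=
    localSign_odd_unit_unit h2 (not_dvd_neg_two_mul hp hq h2 hne) (not_dvd_two_of_prime_ne_two hp h2)
  rw [(neg_two_mul_five_mul_eq p q).1,
    localSign_mul_left p (by exact_mod_cast hp.ne_zero) (by norm_cast; omega) two_ne_zero, e1, e2,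
    mul_one, jacobiSym.legendreSym.to_jacobiSym]

/-- `(−2pq, p)_p = (p, p)_p (−2q, p)_p = (−1/p)·(−2q/p) = −(q/p)` for `p ≡ 5 (mod 8)`.
[cite: Serre1973, Ch. III §1.2 Thm. 1] -/
theorem localSign_prime_neg_n_prime (hp : p.Prime) (hq : q.Prime) (hp8 : p % 8 = 5) (hq4 : q % 4 = 3) :
    localSign p (-((2 * (p * q) : ℕ) : ℤ)) p = -jacobiSym q p := by
  haveI : Fact p.Prime := ⟨hp⟩
  have h2 : p ≠ 2 := by omega
  have hne : p ≠ q := fun h => by omega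
  have hpp : localSign p p p = 1 := by
    unfold localSign
    rw [if_neg h2, localSignOdd_self_self, ZMod.χ₄_nat_eq_if_mod_four]
    simp [show p % 2 = 1 by omega, show p % 4 = 1 by omega]
  have e2 : localSign p (-(2 * (q : ℤ))) p = legendreSym p (-(2 * (q : ℤ))) :=
    localSign_odd_unit_prime h2 (not_dvd_neg_two_mul hp hq h2 hne)
  rw [(neg_two_mul_five_mul_eq p q).1,
    localSign_mul_left p (by exact_mod_cast hp.ne_zero) (by norm_cast; omega)
      (by exact_mod_cast hp.ne_zero), hpp, e2, one_mul, jacobiSym.legendreSym.to_jacobiSym,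
    show (-(2 * (q : ℤ))) = (-1) * 2 * (q : ℤ) by ring, jacobiSym.mul_left, jacobiSym.mul_left,
    jacobiSym_neg_one_eq_one (by omega), jacobiSym_two_eq_neg_one (Or.inr hp8)]
  ring

/-- `(−2pq, q)_p = (p, q)_p (−2q, q)_p = (q/p)`. [cite: Serre1973, Ch. III §1.2 Thm. 1] -/
theorem localSign_prime_neg_n_other (hp : p.Prime) (hq : q.Prime) (hp8 : p % 8 = 5) (hq4 : q % 4 = 3) :
    localSign p (-((2 * (p * q) : ℕ) : ℤ)) q = jacobiSym q p := by
  haveI : Fact p.Prime := ⟨hp⟩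
  have h2 : p ≠ 2 := by omega
  have hne : p ≠ q := fun h => by omega
  have e1 : localSign p p q = legendreSym p q := by
    rw [localSign_comm]
    exact localSign_odd_unit_prime h2 (not_dvd_of_ne hp hq hne)
  have e2 : localSign p (-(2 * (q : ℤ))) q = 1 :=
    localSign_odd_unit_unit h2 (not_dvd_neg_two_mul hp hq h2 hne) (not_dvd_of_ne hp hq hne)
  rw [(neg_two_mul_five_mul_eq p q).1,
    localSign_mul_left p (by exact_mod_cast hp.ne_zero) (by norm_cast; omega)
      (by exact_mod_cast hq.ne_zero), e1, e2, mul_one, jacobiSym.legendreSym.to_jacobiSym]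

/-- `(−2pq, p)_q = (q, p)_q (−2p, p)_q = (p/q)`. [cite: Serre1973, Ch. III §1.2 Thm. 1] -/
theorem localSign_other_neg_n_prime (hp : p.Prime) (hq : q.Prime) (hp8 : p % 8 = 5) (hq4 : q % 4 = 3) :
    localSign q (-((2 * (p * q) : ℕ) : ℤ)) p = jacobiSym p q := by
  haveI : Fact q.Prime := ⟨hq⟩
  have h2 : q ≠ 2 := by omega
  have hne : q ≠ p := fun h => by omega
  have e1 : localSign q q p = legendreSym q p := by
    rw [localSign_comm]
    exact localSign_odd_unit_prime h2 (not_dvd_of_ne hq hp hne)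
  have e2 : localSign q (-(2 * (p : ℤ))) p = 1 :=
    localSign_odd_unit_unit h2 (not_dvd_neg_two_mul hq hp h2 hne) (not_dvd_of_ne hq hp hne)
  rw [(neg_two_mul_five_mul_eq p q).2,
    localSign_mul_left q (by exact_mod_cast hq.ne_zero) (by norm_cast; omega)
      (by exact_mod_cast hp.ne_zero), e1, e2, mul_one, jacobiSym.legendreSym.to_jacobiSym]

/-- `(−2pq, q)_q = (q, q)_q (−2p, q)_q = (−1/q)·(−1/q)(2/q)(p/q) = (2/q)(p/q)`.
[cite: Serre1973, Ch. III §1.2 Thm. 1] -/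
theorem localSign_other_neg_n_other (hp : p.Prime) (hq : q.Prime) (hp8 : p % 8 = 5) (hq4 : q % 4 = 3) :
    localSign q (-((2 * (p * q) : ℕ) : ℤ)) q = jacobiSym 2 q * jacobiSym p q := by
  haveI : Fact q.Prime := ⟨hq⟩
  have h2 : q ≠ 2 := by omega
  have hne : q ≠ p := fun h => by omega
  have hqq : localSign q q q = -1 := by
    unfold localSign
    rw [if_neg h2, localSignOdd_self_self, ZMod.χ₄_nat_eq_if_mod_four]
    simp [show q % 2 = 1 by omega, hq4]
  have hneg : jacobiSym (-1) q = -1 := by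
    rw [jacobiSym.at_neg_one (Nat.odd_iff.mpr (by omega)), ZMod.χ₄_nat_eq_if_mod_four]
    simp [show q % 2 = 1 by omega, hq4]
  have e2 : localSign q (-(2 * (p : ℤ))) q = legendreSym q (-(2 * (p : ℤ))) :=
    localSign_odd_unit_prime h2 (not_dvd_neg_two_mul hq hp h2 hne)
  rw [(neg_two_mul_five_mul_eq p q).2,
    localSign_mul_left q (by exact_mod_cast hq.ne_zero) (by norm_cast; omega)
      (by exact_mod_cast hq.ne_zero), hqq, e2, jacobiSym.legendreSym.to_jacobiSym,
    show (-(2 * (p : ℤ))) = (-1) * 2 * (p : ℤ) by ring, jacobiSym.mul_left, jacobiSym.mul_left, hneg]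
  ring

/-- `(2, p)_2 = χ₈(p) = (2/p)` for an odd prime `p` (as integer signs). [cite: Serre1973, Ch. III §1.2 Thm. 1] -/
theorem localSign_two_two_odd {ℓ : ℕ} (hℓ : ℓ.Prime) (h2 : ℓ ≠ 2) : localSign 2 2 ℓ = jacobiSym 2 ℓ := by
  have hodd : ℓ % 2 = 1 := (Nat.odd_iff.mp (hℓ.odd_of_ne_two h2))
  rw [localSign_two_two_left rfl (by omega), jacobiSym.at_two (Nat.odd_iff.mpr hodd), Int.cast_natCast]

/-! ## §3 Aoki's additive symbols `λ_ℓ(x) ∈ ℤ/2ℤ` on the family -/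

/-- `λ_p(2) = 1` (`(2/p) = −1` for `p ≡ 5 (mod 8)`). [cite: Aoki1999, §2 p. 79] -/
theorem lam_prime_two (hp : p.Prime) (hq : q.Prime) (hp8 : p % 8 = 5) (hq4 : q % 4 = 3) :
    lam (2 * (p * q)) p 2 = 1 := by
  haveI : Fact p.Prime := ⟨hp⟩
  rw [lam_of_ne_two hp (by omega), hilbertBit_eq_one_iff (neg_two_mul_five_mul_ne_zero hp hq) two_ne_zero,
    localSign_prime_neg_n_two hp hq hp8 hq4]
  exact jacobiSym_two_eq_neg_one (Or.inr hp8)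

/-- `λ₂(p) = 1` for `p ≡ 5 (mod 8)` (`χ₈(5) = −1`). [cite: Aoki1999, §2 p. 79] -/
theorem lam_two_prime_five (hp : p.Prime) (hp8 : p % 8 = 5) (n : ℕ) : lam n 2 p = 1 := by
  rw [lam_two, hilbertBit_eq_one_iff two_ne_zero (by exact_mod_cast hp.ne_zero),
    localSign_two_two_odd hp (by omega)]
  exact jacobiSym_two_eq_neg_one (Or.inr hp8)

/-- `λ_p(p) = 0 ↔ (q/p) = −1`. [cite: Aoki1999, §2 p. 79] -/
theorem lam_prime_prime_eq_zero_iff (hp : p.Prime) (hq : q.Prime) (hp8 : p % 8 = 5) (hq4 : q % 4 = 3) :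
    lam (2 * (p * q)) p p = 0 ↔ jacobiSym q p = -1 := by
  haveI : Fact p.Prime := ⟨hp⟩
  rw [lam_of_ne_two hp (by omega), hilbertBit_eq_zero_iff (neg_two_mul_five_mul_ne_zero hp hq)
    (by exact_mod_cast hp.ne_zero), localSign_prime_neg_n_prime hp hq hp8 hq4, neg_eq_iff_eq_neg]

/-- `λ_p(q) = 0 ↔ (q/p) = 1`. [cite: Aoki1999, §2 p. 79] -/
theorem lam_prime_other_eq_zero_iff (hp : p.Prime) (hq : q.Prime) (hp8 : p % 8 = 5) (hq4 : q % 4 = 3) :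
    lam (2 * (p * q)) p q = 0 ↔ jacobiSym q p = 1 := by
  haveI : Fact p.Prime := ⟨hp⟩
  rw [lam_of_ne_two hp (by omega), hilbertBit_eq_zero_iff (neg_two_mul_five_mul_ne_zero hp hq)
    (by exact_mod_cast hq.ne_zero), localSign_prime_neg_n_other hp hq hp8 hq4]

/-- `λ_q(p) = 0 ↔ (p/q) = 1`. [cite: Aoki1999, §2 p. 79] -/
theorem lam_other_prime_eq_zero_iff (hp : p.Prime) (hq : q.Prime) (hp8 : p % 8 = 5) (hq4 : q % 4 = 3) :
    lam (2 * (p * q)) q p = 0 ↔ jacobiSym p q = 1 := by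
  haveI : Fact q.Prime := ⟨hq⟩
  rw [lam_of_ne_two hq (by omega), hilbertBit_eq_zero_iff (neg_two_mul_five_mul_ne_zero hp hq)
    (by exact_mod_cast hp.ne_zero), localSign_other_neg_n_prime hp hq hp8 hq4]

/-- `λ_q(q) = λ₂(q)` when `(p/q) = 1` (both are the bit of `(2/q)`). [cite: Aoki1999, §2 p. 79] -/
theorem lam_other_other_eq_lam_two (hp : p.Prime) (hq : q.Prime) (hp8 : p % 8 = 5) (hq4 : q % 4 = 3)
    (hj : jacobiSym p q = 1) : lam (2 * (p * q)) q q = lam (2 * (p * q)) 2 q := by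
  haveI : Fact q.Prime := ⟨hq⟩
  rw [lam_of_ne_two hq (by omega), lam_two, hilbertBit_eq_of_localSign (neg_two_mul_five_mul_ne_zero hp hq)
    (by exact_mod_cast hq.ne_zero), hilbertBit_eq_of_localSign two_ne_zero
    (by exact_mod_cast hq.ne_zero), localSign_other_neg_n_other hp hq hp8 hq4, hj, mul_one,
    localSign_two_two_odd hq (by omega)]

end Family

/-! ## §4 Two rank lemmas over a field -/

section Rank

/-- A matrix with a non-zero entry has rank `≥ 1` (the column through that entry is a non-zero
element of the column space). [folklore] -/
theorem one_le_rank_of_ne_zero {m k : Type*} [Fintype k] {R : Type*} [Field R]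
    (A : Matrix m k R) {i : m} {j : k} (h : A i j ≠ 0) : 1 ≤ A.rank := by
  unfold Matrix.rank
  refine Nat.one_le_iff_ne_zero.mpr fun h0 => ?_
  rw [Submodule.finrank_eq_zero] at h0
  have hmem : A.mulVec (Pi.single j 1) ∈ LinearMap.range A.mulVecLin := ⟨Pi.single j 1, rfl⟩
  rw [h0, Submodule.mem_bot, Matrix.mulVec_single_one] at hmem
  exact h (congrFun hmem i)

/-- A matrix whose column index type has exactly one element and which has a non-zero entry has
rank exactly `1`. [folklore] -/
theorem rank_eq_one_of_card_eq_one {m k : Type*} [Fintype k] {R : Type*} [Field R]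
    (A : Matrix m k R) (hk : Fintype.card k = 1) {i : m} {j : k} (h : A i j ≠ 0) : A.rank = 1 :=
  le_antisymm (hk ▸ A.rank_le_card_width) (one_le_rank_of_ne_zero A h)

end Rank

end Summit.BirchSwinnertonDyer.Rank1Residual.P2

end
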